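import Literature.AlgebraicGeometry.GroupSchemes.GroupSchemeKernel
import Mathlib.AlgebraicGeometry.Morphisms.FlatRank
import HarnessLib

/-!
# The kernel shear `G ×_H G ≅ G × Ker φ` of a homomorphism, and the rank of a homomorphism with finite flat kernel

Topic `Literature/AlgebraicGeometry/GroupSchemes`; namespace `Literature.AlgebraicGeometry.GroupSchemes.GroupSchemeKernel` (complements
to ★ `GroupSchemes/GroupSchemeKernel`).  Theorems only (no definition, no named fact, no instance, no notation, no `sorry`).
Cell `hodgecm-mathlib` (D-0151), FLOOR 0, P6 «MOD programme», generic organ for the HEIGHT clause of the P6b line's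
`stub_L42_idempotentSplitting` («rank (source) = rank (kernel) · rank (target)» for a flat surjective homomorphism of finite flat
group schemes, e.g. the `[p]`-maps `Fix ε_{n+1} → Fix ε_n` of the fixed Barsotti–Tate group); `--supports stmt-HodgeConjecture-24832`,
COUNT-NEUTRAL (HC_CM is proved only modulo the printed citations until rung 0 closes; nothing here is about HC).

THE PRINT.  [GortzWedhorn2020] (4.15) Definition 4.45 (2): the kernel `Ker φ = G ×_{H, e} S` of a homomorphism of group schemes; the
translation formula «`φ(x) = φ(y) ⟺ x⁻¹ y ∈ Ker φ`», i.e. `G ×_{φ, H, φ} G ≅ G ×_S Ker φ`, `(x, y) ↦ (x, x⁻¹ y)` (the shear of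
[GortzWedhorn2023] (27.9.1), «`f⁻¹(f(x)) = x · Ker f`»), whence, for `φ` finite flat, the rank of `φ` at `φ(x)` is the rank of
`Ker φ → S` at the image of `x` ([StacksProject, Tag 02KA]: the rank of a finite locally free morphism is stable under base change —
Mathlib `Scheme.Hom.finrank_of_isPullback`, `finrank_pullback_fst`).

WHAT IS HERE (for `φ : G ⟶ H` a homomorphism of group objects and ANY cartesian square `K →(i) G →(φ) H ←(e) 𝟙`, so that `K`
may be a chosen model of the kernel rather than Mathlib's `pullback`):
* §1 (any cartesian monoidal category) `comp_eq_one_of_isPullback_unit`, `inv_mul_comp_eq_toUnit_comp_unit`, and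
  **`isPullback_fst_mul_of_isPullback_unit`** — the square `G ⊗ K ⇉ G → H` with `pr₁` and the multiplication `(x, k) ↦ x · i(k)`
  is CARTESIAN (the kernel shear, stated as an `IsPullback` so that no auxiliary definition is needed);
* §2 (`Over S`) **`finrank_left_apply_eq_finrank_hom`** — `rank_{φ x} φ = rank_{s} (K → S)` for `φ.left` finite flat and `K → S`
  finite flat; **`finrank_left_eq_of_forall_finrank_hom_eq`** — `φ` surjective and `K → S` of constant rank `d` ⇒ `φ` of constant
  rank `d`.

## References
* [GortzWedhorn2020] U. Görtz, T. Wedhorn, *Algebraic Geometry I*, 2nd ed. (2020), (4.15) Definition 4.45 (2) (p. 117).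
* [GortzWedhorn2023] U. Görtz, T. Wedhorn, *Algebraic Geometry II* (2023), (27.9.1) in Lemma 27.59.
* [StacksProject] The Stacks Project, Tag 02KA (rank of a finite locally free morphism; base change).
-/

noncomputable section

universe v u

open CategoryTheory CategoryTheory.Limits AlgebraicGeometry MonoidalCategory CartesianMonoidalCategory

namespace Literature.AlgebraicGeometry.GroupSchemes

namespace GroupSchemeKernel

open scoped MonObj

/-! ## §1 The shear square: `G ⊗ K` with `(pr₁, (x, k) ↦ x · k)` is the fibre product `G ×_{φ, H, φ} G` -/

section Shear

variable {C : Type u} [Category.{v} C] [CartesianMonoidalCategory C]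
variable {G H K : C} [GrpObj G] [GrpObj H] (φ : G ⟶ H) [IsMonHom φ] (i : K ⟶ G)

omit [GrpObj G] [IsMonHom φ] in
/-- In a kernel square `K →(i) G →(φ) H ←(e) 𝟙`, `i ≫ φ = 1`. [cite: GortzWedhorn2020, Definition 4.45 (2), p. 117] -/
theorem comp_eq_one_of_isPullback_unit (hK : IsPullback i (toUnit K) φ η[H]) : i ≫ φ = 1 := by
  rw [hK.w, Hom.one_def]

/-- For `a, b : T ⟶ G` with `a ≫ φ = b ≫ φ`, the quotient `a⁻¹ b` lies in the kernel: `(a⁻¹ b) ≫ φ = 1`.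
[cite: GortzWedhorn2020, Definition 4.45 (2), p. 117] -/
theorem inv_mul_comp_eq_toUnit_comp_unit {T : C} (a b : T ⟶ G) (hab : a ≫ φ = b ≫ φ) :
    (a⁻¹ * b) ≫ φ = toUnit T ≫ η[H] := by
  rw [MonObj.mul_comp, GrpObj.inv_comp, hab, inv_mul_cancel, Hom.one_def]

/-- **THE KERNEL SHEAR.**  For a homomorphism `φ : G → H` of group objects with kernel `K` (any cartesian square
`K →(i) G →(φ) H ←(e) 𝟙`), the square `G ⊗ K ⇉ G → H` with the projection `(x, k) ↦ x` and the multiplication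
`(x, k) ↦ x · i(k)` is CARTESIAN, i.e. `(pr₁, mult) : G ⊗ K ≅ G ×_{φ, H, φ} G` — the categorical form of
«`φ⁻¹(φ(x)) = x · Ker φ`»; the inverse is `(x, y) ↦ (x, x⁻¹ y)`. [cite: GortzWedhorn2020, Definition 4.45 (2), p. 117] -/
theorem isPullback_fst_mul_of_isPullback_unit (hK : IsPullback i (toUnit K) φ η[H]) :
    IsPullback (fst G K) (fst G K * (snd G K ≫ i)) φ φ := by
  have hw : fst G K ≫ φ = (fst G K * (snd G K ≫ i)) ≫ φ := by
    rw [MonObj.mul_comp, Category.assoc, comp_eq_one_of_isPullback_unit φ i hK, MonObj.comp_one, mul_one]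
  refine IsPullback.of_isLimit' ⟨hw⟩ (PullbackCone.IsLimit.mk hw
    (fun s => lift s.fst (hK.lift (s.fst⁻¹ * s.snd) (toUnit s.pt)
      (inv_mul_comp_eq_toUnit_comp_unit φ s.fst s.snd s.condition)))
    (fun s => lift_fst _ _) (fun s => ?_) (fun s m hm₁ hm₂ => ?_))
  · rw [MonObj.comp_mul, lift_fst, lift_snd_assoc, hK.lift_fst, mul_inv_cancel_left]
  · apply CartesianMonoidalCategory.hom_ext
    · rw [lift_fst, hm₁]
    · rw [lift_snd]
      apply hK.hom_ext
      · rw [hK.lift_fst, eq_inv_mul_iff_mul_eq, ← hm₁, Category.assoc, ← MonObj.comp_mul, hm₂]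
      · exact toUnit_unique _ _

end Shear

/-! ## §2 Over a base scheme: the rank of a homomorphism equals the rank of its kernel -/

section Rank

variable {S : Scheme.{u}} {G H K : Over S} [GrpObj G] [GrpObj H] (φ : G ⟶ H) [IsMonHom φ] (i : K ⟶ G)

/-- **The rank of a homomorphism with finite flat kernel**: for `φ : G → H` a homomorphism of `S`-group schemes whose
underlying morphism is finite and flat, with kernel `K → S` finite and flat, the rank of `φ` at `φ x` is the rank of
`K → S` at the image of `x` in `S` — base change of the rank along `φ` itself and the kernel shear
`G ×_H G ≅ G ×_S K` over `G` (`isPullback_fst_mul_of_isPullback_unit`; Mathlib `Scheme.Hom.finrank_of_isPullback`,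
`finrank_pullback_fst`). [cite: GortzWedhorn2020, Definition 4.45 (2), p. 117] -/
theorem finrank_left_apply_eq_finrank_hom (hK : IsPullback i (toUnit K) φ η[H]) [IsFinite φ.left] [Flat φ.left]
    [IsFinite K.hom] [Flat K.hom] (x : G.left) : φ.left.finrank (φ.left x) = K.hom.finrank (G.hom x) := by
  -- the shear square on underlying schemes, flipped: `rank_{φ x} φ = rank_x (pr₁ : G ×_S K → G)`
  have hsq : IsPullback (fst G K * (snd G K ≫ i)).left (fst G K).left φ.left φ.left :=
    ((isPullback_fst_mul_of_isPullback_unit φ i hK).map (Over.forget S)).flip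
  rw [← Scheme.Hom.finrank_of_isPullback _ _ _ _ hsq x]
  -- and `pr₁ : G ×_S K → G` is the base change of `K → S` along `G → S`
  change (pullback.fst G.hom K.hom).finrank x = _
  haveI : IsFinite (pullback.fst G.hom K.hom) := MorphismProperty.pullback_fst _ _ inferInstance
  haveI : Flat (pullback.fst G.hom K.hom) := MorphismProperty.pullback_fst _ _ inferInstance
  exact Scheme.Hom.finrank_pullback_fst K.hom G.hom x

/-- If moreover `φ` is surjective and `K → S` has constant rank `d`, then `φ` has constant rank `d`.
[cite: GortzWedhorn2020, Definition 4.45 (2), p. 117] -/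
theorem finrank_left_eq_of_forall_finrank_hom_eq (hK : IsPullback i (toUnit K) φ η[H]) [IsFinite φ.left] [Flat φ.left]
    [Surjective φ.left] [IsFinite K.hom] [Flat K.hom] (d : ℕ) (hd : ∀ s, K.hom.finrank s = d) (y : H.left) :
    φ.left.finrank y = d := by
  obtain ⟨x, rfl⟩ := φ.left.surjective y
  rw [finrank_left_apply_eq_finrank_hom φ i hK, hd]

end Rank

end GroupSchemeKernel

end Literature.AlgebraicGeometry.GroupSchemes

end
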